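import Literature.MathematicalPhysics.QuantumFieldTheory.Balaban1983to89.TreeLengthTorusGeometry236
import Literature.MathematicalPhysics.QuantumFieldTheory.Balaban1983to89.B13FamilySum
import Literature.MathematicalPhysics.QuantumFieldTheory.Balaban1983to89.B12Decay510Window

/-!
# NE9TorusSizeDichotomy — the linear size `d_j` of the cell's TORUS model takes no value in `(0, 1)`; the `d_j = 0` class through a
# cube has at most `2^d·2^(2^d)` members; hence [II] (1.26) ABOVE ITS THRESHOLD over any catalogue: `Σ_{X ∋ □′} e^{−κ d_j(X)} ≤ N₀ + K₀·e^{−(κ−κ₀)}`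
# (cell `pub-balaban`, T4-DAG §2 node U3 / §6 rows NE9 ∕ NE5; NE9 formalisation swarm LEAF PROVER 05, lineage leaf-05, generation 3; part 1 of 2 —
# part 2 `NE9RecordIneq126Above` applies this on the carriers of record `B13Carriers.TwoRuns.carriers`)

HONEST FRAMING (T4-DAG PAGE 1).  Rung (B)+1 of the FINITE-VOLUME T⁴ programme — existence AND uniqueness of the ε → 0 limit of
gauge-invariant observables on a fixed torus; NOT infinite volume, NOT a mass gap, NOT the Clay problem.  NE9 (`T4OutputRate.NE9` ∧
`FadingMemory`) is a cell NEW ESTIMATE, NOT PRINTED, and is NOT discharged here («NE9 ⇐ the named binders»); spine 0/9 unchanged; 0/18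
leaves instantiated on Bałaban's objects.  HONEST DEPENDENCY (cell line, verbatim): continuum YM on T⁴ ⇐ BetaPertH ∧ nine spine estimates
(0/9 proved); BetaPertH ⇐ (D1) ∧ (D4) ∧ CAP+tail; G-an2-4 gates asym, D1 and NE2/3/4.  `FlowStep.BetaPertH`, (B), (B^μ) do not occur here.
[II] = [Balaban1988RG2Cluster] is quoted for TYPES only (ABSOLUTE RULE: nothing printed in the audited series is asserted).

WHY (the located point is spelled out in part 2).  The tree's (1.26) on the periodic carrier (`TreeLengthTorus.ineq126_torus`, transported to
the carriers of record as `B13DomainGeometryTR.ineq126_level`) is the THRESHOLD form: rate `κ₀ = c₀·a₀`, constant `K₀ = e^{κ₀}·b`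
(`B12TreeDecay.K₀`; for d = 4: `κ₀ = 64·log 162`, `K₀ = 162⁶⁴/81 > 10¹³⁹`).  Print's remark after (1.26), p. 8 l. 11–13, verbatim: *"for κ
sufficiently large. The number O(1) is in fact small, because we sum over X with d_j(X) ≠ 0, as it follows from our inductive
construction."* — on the cell's MODEL of `d_j` (`TreeLengthTorus.torusTreeLen`, reading D-pv22g2.1) this becomes a theorem once one knows
that `d_j ≠ 0` forces `d_j ≥ 1`.  THIS FILE (kernel, no new definition, no `def … : Prop`):
* §1 **the torus dichotomy** `torusTreeLen X̄ = 0 ∨ 1 ≤ torusTreeLen X̄` for EVERY finite family of cubes of the torus `(ℤ/N)^d` (the window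
  twin `TreeLengthDichotomy.treeLen_dichotomy` is in the tree for `ℤ^d` only): two met lifts two apart in a coordinate cost length ≥ 1
  (two points of a connected graph are within its length, `B12Decay510Window.dist_le_len` BY NAME), otherwise the met lifts pairwise
  touch and the one-point graph has length 0 (`TreeLengthTorusGeometry236.tAdmissible_point`, `B13Geometry236.exists_common_point` BY NAME);
* §2 **the `d_j = 0` class through a cube is small**: among torus localization domains, `#{Ȳ ∋ c̄ : torusTreeLen Ȳ = 0} ≤ 2^d·2^(2^d)`
  (`= 2²⁰` for `d = 4`; re-sheeting `TreeLengthTorusGeometry.exists_translate_meets` puts the met lift of `c̄` at `natLift c̄`; the met lifts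
  pairwise touch, hence lie in one of `2^d` blocks of `2^d` cubes, and `Ȳ` is the projection of a subset);
* §3 **(1.26) above threshold, abstract** over `B13FamilySum.Ineq126`: threshold form + dichotomy + `d = 0` count `N₀` + `κ₀ ≤ κ` ⇒
  `Ineq126 S cubes d κ (N₀ + K₀·e^{−(κ−κ₀)})`, together with the remark's quantitative form `Σ_{Y ∋ c, d Y ≠ 0} e^{−κ d(Y)} ≤ K₀·e^{−(κ−κ₀)}`.
DISGUISE TEST: lattice geometry and real arithmetic about a catalogue of domains; no activity, no history — not NE9, not NE5.

References (TYPES only): T. Bałaban, *Renormalization group approach to lattice gauge field theories. II. Cluster expansions*, Commun.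
Math. Phys. **116**, 1–22 (1988) [Balaban1988RG2Cluster], (1.26) p. 8 with the remark l. 11–13 (render
`b2b-balaban-ref1/pages/1988-cmp116-rg-II-cluster/1988-cmp116-rg-II-cluster-p008-x2.png` re-read as an image by this seat, 2026-08-20);
T. Bałaban, *… I*, Commun. Math. Phys. **109**, 249–301 (1987) [Balaban1987RG1], p. 257 (the linear size d_j).  Summits-side NEW work
(LEAN PLACEMENT RULE); imports `TreeLengthTorusGeometry236` (lifts, one-point graphs, common points), `B13FamilySum` (`Ineq126`) and
`B12Decay510Window` (`dist_le_len`) only;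
modifies nothing; 0 sorry.  Value = kernel bookkeeping on the cell's geometry, NOT summit progress.
-/

noncomputable section

open scoped BigOperators

namespace Summit.QuantumFields.BalabanUV.T4Continuum.NE9TorusSizeDichotomy

open Literature.MathematicalPhysics.QuantumFieldTheory.Balaban1983to89
open Literature.MathematicalPhysics.QuantumFieldTheory.Balaban1983to89.B13ScaleTransfer (Pt)
open Literature.MathematicalPhysics.QuantumFieldTheory.Balaban1983to89.TreeLength
open Literature.MathematicalPhysics.QuantumFieldTheory.Balaban1983to89.TreeLengthTorus
open Literature.MathematicalPhysics.QuantumFieldTheory.Balaban1983to89.TreeLengthTorusGeometry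
  (exists_translate_meets finset_nonempty_of_tAdmissible)
open Literature.MathematicalPhysics.QuantumFieldTheory.Balaban1983to89.TreeLengthTorusGeometry236 (tAdmissible_point)
open Literature.MathematicalPhysics.QuantumFieldTheory.Balaban1983to89.B13Geometry236 (exists_common_point)
open Literature.MathematicalPhysics.QuantumFieldTheory.Balaban1983to89.B13FamilySum (Ineq126)

variable {d N : ℕ}

/-! ## §1 The torus dichotomy: `d_j(X̄) = 0` or `d_j(X̄) ≥ 1` -/

/-- Two unit cubes of `ℝ^d` met by a connected graph of length `< 1` TOUCH: their indices differ by at most `1` in every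
coordinate (`B12Decay510Window.dist_le_len` + the cube inequalities). [folklore] -/
theorem le_add_one_of_met {T : List (Seg d)} (hT : IsPreconnected (carrier T)) (hlen : len T < 1) {x y : Pt d}
    {p q : RPt d} (hp : p ∈ carrier T) (hpx : p ∈ cube x) (hq : q ∈ carrier T) (hqy : q ∈ cube y) (μ : Fin d) :
    y μ ≤ x μ + 1 := by
  have hd : dist p q < 1 := (B12Decay510Window.dist_le_len hT hp hq).trans_lt hlen
  have hμ : dist (p μ) (q μ) < 1 := (dist_le_pi_dist p q μ).trans_lt hd
  rw [Real.dist_eq] at hμ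
  have hp1 := (mem_cube.1 hpx μ).2
  have hq1 := (mem_cube.1 hqy μ).1
  have hlt : ((y μ : ℤ) : ℝ) < (x μ : ℝ) + 2 := by
    have := (abs_lt.1 hμ).1
    linarith
  have hlt' : y μ < x μ + 2 := by exact_mod_cast hlt
  omega

/-- For a torus-admissible graph of length `< 1`, any chosen met lifts `f a` (`a ∈ X̄`) PAIRWISE TOUCH. [folklore] -/
theorem near_image_of_len_lt_one {X : Finset (TPt d N)} {T : List (Seg d)} (hT : TAdmissible X T) (hlen : len T < 1)
    {f : TPt d N → Pt d} (hf : ∀ a ∈ X, (carrier T ∩ cube (f a)).Nonempty) :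
    ∀ c₁ ∈ X.image f, ∀ c₂ ∈ X.image f, ∀ μ, c₂ μ ≤ c₁ μ + 1 := by
  intro c₁ hc₁ c₂ hc₂ μ
  obtain ⟨a₁, ha₁, rfl⟩ := Finset.mem_image.1 hc₁
  obtain ⟨a₂, ha₂, rfl⟩ := Finset.mem_image.1 hc₂
  obtain ⟨p, hpT, hpx⟩ := hf a₁ ha₁
  obtain ⟨q, hqT, hqy⟩ := hf a₂ ha₂
  exact le_add_one_of_met hT.connected.isPreconnected hlen hpT hpx hqT hqy μ

/-- A torus family admitting an admissible graph of length `< 1` has `d_j = 0`: the met lifts pairwise touch, so they have a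
common point (`exists_common_point`) and the one-point graph there is admissible (`tAdmissible_point`). [folklore] -/
theorem torusTreeLen_eq_zero_of_len_lt_one {X : Finset (TPt d N)} {T : List (Seg d)} (hT : TAdmissible X T)
    (hlen : len T < 1) : torusTreeLen X = 0 := by
  classical
  choose! f hfproj hfmeets using hT.meets
  have hXne : X.Nonempty := finset_nonempty_of_tAdmissible hT
  obtain ⟨q, hq⟩ := exists_common_point (hXne.image f) (near_image_of_len_lt_one hT hlen hfmeets)
  have hadm : TAdmissible X [(q, q)] :=
    tAdmissible_point hXne fun c hc => ⟨f c, hfproj c hc, hq (f c) (Finset.mem_image_of_mem f hc)⟩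
  have h1 := torusTreeLen_le_len hadm
  have h0 : len [(q, q)] = 0 := by simp
  linarith [torusTreeLen_nonneg X]

/-- If `d_j(X̄) < 1` and `X̄` has an admissible graph at all, it has one of length `< 1`. [folklore] -/
theorem exists_tAdmissible_len_lt_one {X : Finset (TPt d N)} (hne : ∃ T, TAdmissible X T) (h : torusTreeLen X < 1) :
    ∃ T, TAdmissible X T ∧ len T < 1 := by
  obtain ⟨T₀, hT₀⟩ := hne
  obtain ⟨ℓ, ⟨T, hT, rfl⟩, hℓ⟩ := exists_lt_of_csInf_lt (s := tlengths X) ⟨len T₀, T₀, hT₀, rfl⟩ h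
  exact ⟨T, hT, hℓ⟩

/-- **THE TORUS DICHOTOMY**: for every finite family `X̄` of cubes of the torus `(ℤ/N)^d`, `d_j(X̄) = 0` or `d_j(X̄) ≥ 1` — the cell's
model `torusTreeLen` of the printed linear size ([Balaban1987RG1] p. 257) takes no value strictly between `0` and `1` (families
without admissible graphs have the junk value `0`). [folklore] -/
theorem torusTreeLen_dichotomy (X : Finset (TPt d N)) : torusTreeLen X = 0 ∨ 1 ≤ torusTreeLen X := by
  by_cases hne : ∃ T, TAdmissible X T
  · by_cases h1 : 1 ≤ torusTreeLen X
    · exact Or.inr h1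
    · push Not at h1
      obtain ⟨T, hT, hlt⟩ := exists_tAdmissible_len_lt_one hne h1
      exact Or.inl (torusTreeLen_eq_zero_of_len_lt_one hT hlt)
  · left
    have he : tlengths X = ∅ := by
      ext ℓ
      simp only [tlengths, Set.mem_setOf_eq, Set.mem_empty_iff_false, iff_false]
      rintro ⟨T, hT, -⟩
      exact hne ⟨T, hT⟩
    rw [torusTreeLen, he, Real.sInf_empty]

/-- `d_j(X̄) < 1 ↔ d_j(X̄) = 0` on the torus. [folklore] -/
theorem torusTreeLen_lt_one_iff (X : Finset (TPt d N)) : torusTreeLen X < 1 ↔ torusTreeLen X = 0 := by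
  constructor
  · intro h
    rcases torusTreeLen_dichotomy X with h0 | h1
    · exact h0
    · exact absurd h (not_lt.2 h1)
  · intro h
    rw [h]
    exact one_pos

/-- `d_j(X̄) ≠ 0 ↔ d_j(X̄) ≥ 1` on the torus — the quantitative content of print's *"we sum over X with d_j(X) ≠ 0"*
([Balaban1988RG2Cluster] p. 8 l. 12–13) on the cell's model. [folklore] -/
theorem torusTreeLen_ne_zero_iff (X : Finset (TPt d N)) : torusTreeLen X ≠ 0 ↔ 1 ≤ torusTreeLen X := by
  constructor
  · intro h
    rcases torusTreeLen_dichotomy X with h0 | h1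
    · exact absurd h0 h
    · exact h1
  · intro h h0
    rw [h0] at h
    exact absurd h (by norm_num)

/-! ## §2 The `d_j = 0` class through a cube is small -/

/-- **RE-SHEETED LIFTS IN ONE BLOCK.**  If a torus localization domain `Ȳ ∋ c̄` (non-empty, torus-face-connected, `N ≥ 1`) has `d_j(Ȳ) = 0`,
then `Ȳ` is the projection of a family `B ⊆ ℤ^d` of cubes lying in the block `∏_μ {m_μ, m_μ + 1}` for some corner `m` with
`m_μ ∈ {(natLift c̄)_μ − 1, (natLift c̄)_μ}` — the met lifts of a short admissible graph re-sheeted through `natLift c̄`. [folklore] -/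
theorem exists_block_of_torusTreeLen_eq_zero [NeZero N] {Y : Finset (TPt d N)} (hYne : Y.Nonempty) (hYc : TFaceConnected Y)
    {c : TPt d N} (hcY : c ∈ Y) (hY0 : torusTreeLen Y = 0) :
    ∃ m ∈ Fintype.piFinset (fun μ => ({natLift c μ - 1, natLift c μ} : Finset ℤ)),
      ∃ B ⊆ Fintype.piFinset (fun μ => ({m μ, m μ + 1} : Finset ℤ)), Y = B.image (proj N) := by
  classical
  obtain ⟨T₀, hT₀, -⟩ := exists_tAdmissible hYne hYc
  obtain ⟨T₁, hT₁, hlt₁⟩ := exists_tAdmissible_len_lt_one ⟨T₀, hT₀⟩ (by rw [hY0]; exact one_pos)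
  obtain ⟨T, hT, hlenT, hmeet⟩ := exists_translate_meets hT₁ hcY (proj_natLift c)
  have hlt : len T < 1 := hlenT ▸ hlt₁
  choose! f hfproj hfmeets using hT.meets
  set x₀ : Pt d := natLift c with hx₀
  -- the re-sheeted choice of lifts: the cube `c̄` is lifted to `natLift c̄`
  set g : TPt d N → Pt d := fun a => if a = c then x₀ else f a with hg
  have hgc : g c = x₀ := by
    show (if c = c then x₀ else f c) = x₀
    rw [if_pos rfl]
  have hgne : ∀ a, a ≠ c → g a = f a := by
    intro a hac
    show (if a = c then x₀ else f a) = f a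
    rw [if_neg hac]
  have hgproj : ∀ a ∈ Y, proj N (g a) = a := by
    intro a ha
    by_cases hac : a = c
    · rw [hac, hgc, hx₀, proj_natLift]
    · rw [hgne a hac]; exact hfproj a ha
  have hgmeets : ∀ a ∈ Y, (carrier T ∩ cube (g a)).Nonempty := by
    intro a ha
    by_cases hac : a = c
    · rw [hac, hgc]; exact hmeet
    · rw [hgne a hac]; exact hfmeets a ha
  set B : Finset (Pt d) := Y.image g with hB
  have hx₀B : x₀ ∈ B := Finset.mem_image.2 ⟨c, hcY, hgc⟩
  have hBne : B.Nonempty := ⟨x₀, hx₀B⟩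
  have hnear : ∀ c₁ ∈ B, ∀ c₂ ∈ B, ∀ μ, c₂ μ ≤ c₁ μ + 1 := near_image_of_len_lt_one hT hlt hgmeets
  -- the lower corner of the block
  set m : Pt d := fun μ => B.inf' hBne fun x => x μ with hm
  have hm_le : ∀ x ∈ B, ∀ μ, m μ ≤ x μ := fun x hx μ => Finset.inf'_le (fun x : Pt d => x μ) hx
  have hle_m : ∀ x ∈ B, ∀ μ, x μ ≤ m μ + 1 := by
    intro x hx μ
    obtain ⟨y, hy, hyeq⟩ := Finset.exists_mem_eq_inf' hBne (fun x : Pt d => x μ)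
    have h := hnear y hy x hx μ
    have hmy : m μ = y μ := hyeq
    rw [hmy]
    exact h
  refine ⟨m, ?_, B, ?_, ?_⟩
  · rw [Fintype.mem_piFinset]
    intro μ
    have h1 := hm_le x₀ hx₀B μ
    have h2 := hle_m x₀ hx₀B μ
    rw [Finset.mem_insert, Finset.mem_singleton]
    omega
  · intro x hx
    rw [Fintype.mem_piFinset]
    intro μ
    have h1 := hm_le x hx μ
    have h2 := hle_m x hx μ
    rw [Finset.mem_insert, Finset.mem_singleton]
    omega
  · ext a
    constructor
    · intro ha
      exact Finset.mem_image.2 ⟨g a, Finset.mem_image_of_mem g ha, hgproj a ha⟩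
    · intro ha
      obtain ⟨x, hx, rfl⟩ := Finset.mem_image.1 ha
      obtain ⟨a', ha', rfl⟩ := Finset.mem_image.1 hx
      rw [hgproj a' ha']
      exact ha'

/-- **THE `d_j = 0` CLASS THROUGH A CUBE IS SMALL**: in any catalogue `S` of torus localization domains (non-empty, torus-face-connected
families of cubes of `(ℤ/N)^d`, `N ≥ 1`), the members containing a given cube `c̄` and of linear size `0` number at most `2^d·2^(2^d)`
(`= 2²⁰` for `d = 4`). [folklore] -/
theorem card_filter_torusTreeLen_eq_zero_le [NeZero N] (S : Finset (Finset (TPt d N)))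
    (hS : ∀ Y ∈ S, Y.Nonempty ∧ TFaceConnected Y) (c : TPt d N) :
    (S.filter fun Y => c ∈ Y ∧ torusTreeLen Y = 0).card ≤ 2 ^ d * 2 ^ (2 ^ d) := by
  classical
  set M : Finset (Pt d) := Fintype.piFinset (fun μ => ({natLift c μ - 1, natLift c μ} : Finset ℤ)) with hM
  set blk : Pt d → Finset (Pt d) := fun m => Fintype.piFinset (fun μ => ({m μ, m μ + 1} : Finset ℤ)) with hblk
  set F : Finset (Finset (TPt d N)) := M.biUnion fun m => (blk m).powerset.image fun B => B.image (proj N) with hF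
  have hsub : (S.filter fun Y => c ∈ Y ∧ torusTreeLen Y = 0) ⊆ F := by
    intro Y hY
    rw [Finset.mem_filter] at hY
    obtain ⟨hYS, hcY, hY0⟩ := hY
    obtain ⟨m, hm, B, hB, hYB⟩ := exists_block_of_torusTreeLen_eq_zero (hS Y hYS).1 (hS Y hYS).2 hcY hY0
    rw [hF, Finset.mem_biUnion]
    exact ⟨m, hm, Finset.mem_image.2 ⟨B, Finset.mem_powerset.2 hB, hYB.symm⟩⟩
  have hpi : ∀ (t : Fin d → Finset ℤ), (∀ μ, (t μ).card ≤ 2) → (Fintype.piFinset t).card ≤ 2 ^ d := by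
    intro t ht
    rw [Fintype.card_piFinset]
    calc ∏ μ, (t μ).card ≤ ∏ _μ : Fin d, 2 := Finset.prod_le_prod' fun μ _ => ht μ
      _ = 2 ^ d := by rw [Finset.prod_const, Finset.card_univ, Fintype.card_fin]
  have hMcard : M.card ≤ 2 ^ d := hpi _ fun μ => Finset.card_le_two
  have hblkcard : ∀ m, (blk m).card ≤ 2 ^ d := fun m => hpi _ fun μ => Finset.card_le_two
  calc (S.filter fun Y => c ∈ Y ∧ torusTreeLen Y = 0).card ≤ F.card := Finset.card_le_card hsub
    _ ≤ ∑ m ∈ M, ((blk m).powerset.image fun B => B.image (proj N)).card := Finset.card_biUnion_le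
    _ ≤ ∑ _m ∈ M, 2 ^ (2 ^ d) := by
        refine Finset.sum_le_sum fun m _ => Finset.card_image_le.trans ?_
        rw [Finset.card_powerset]
        exact Nat.pow_le_pow_right (by norm_num) (hblkcard m)
    _ = M.card * 2 ^ (2 ^ d) := by rw [Finset.sum_const, smul_eq_mul]
    _ ≤ 2 ^ d * 2 ^ (2 ^ d) := Nat.mul_le_mul_right _ hMcard

/-! ## §3 (1.26) above its threshold, over an abstract catalogue -/

section Abstract

variable {Dom Cube : Type*} [DecidableEq Cube]

/-- **PRINT's REMARK, QUANTITATIVE FORM** ([Balaban1988RG2Cluster] p. 8 l. 11–13, verbatim: *"The number O(1) is in fact small, because we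
sum over X with d_j(X) ≠ 0"* — quoted as a TYPE; what is proved is about an abstract catalogue): if (1.26) holds at `κ₀` with constant `K₀`
and the sizes in the catalogue are `0` or `≥ 1`, then for every `κ ≥ κ₀` the part of the (1.26)-sum over the domains with `d ≠ 0` is at
most `K₀·e^{−(κ−κ₀)}` — exponentially small above threshold. [cite: Balaban1988RG2Cluster, (1.26) p.8] -/
theorem sum_filter_ne_zero_le {S : Finset Dom} {cubes : Dom → Finset Cube} {dl : Dom → ℝ} {κ₀ K₀ κ : ℝ}
    (h126 : Ineq126 S cubes dl κ₀ K₀) (hgap : ∀ Y ∈ S, dl Y = 0 ∨ 1 ≤ dl Y) (hκ : κ₀ ≤ κ) (c : Cube) :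
    ∑ Y ∈ (S.filter fun Y => c ∈ cubes Y).filter (fun Y => dl Y ≠ 0), Real.exp (-(κ * dl Y))
      ≤ K₀ * Real.exp (-(κ - κ₀)) := by
  have hc := h126 c
  have hstep : ∀ Y ∈ (S.filter fun Y => c ∈ cubes Y).filter (fun Y => dl Y ≠ 0),
      Real.exp (-(κ * dl Y)) ≤ Real.exp (-(κ - κ₀)) * Real.exp (-(κ₀ * dl Y)) := by
    intro Y hY
    rw [Finset.mem_filter] at hY
    have hYS : Y ∈ S := (Finset.mem_filter.1 hY.1).1
    have h1 : 1 ≤ dl Y := by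
      rcases hgap Y hYS with h0 | h1
      · exact absurd h0 hY.2
      · exact h1
    rw [← Real.exp_add]
    apply Real.exp_le_exp.2
    nlinarith
  calc ∑ Y ∈ (S.filter fun Y => c ∈ cubes Y).filter (fun Y => dl Y ≠ 0), Real.exp (-(κ * dl Y))
      ≤ ∑ Y ∈ (S.filter fun Y => c ∈ cubes Y).filter (fun Y => dl Y ≠ 0),
          Real.exp (-(κ - κ₀)) * Real.exp (-(κ₀ * dl Y)) := Finset.sum_le_sum hstep
    _ = Real.exp (-(κ - κ₀)) * ∑ Y ∈ (S.filter fun Y => c ∈ cubes Y).filter (fun Y => dl Y ≠ 0),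
          Real.exp (-(κ₀ * dl Y)) := by rw [Finset.mul_sum]
    _ ≤ Real.exp (-(κ - κ₀)) * ∑ Y ∈ S.filter (fun Y => c ∈ cubes Y), Real.exp (-(κ₀ * dl Y)) :=
        mul_le_mul_of_nonneg_left
          (Finset.sum_le_sum_of_subset_of_nonneg (Finset.filter_subset (fun Y => dl Y ≠ 0) _)
            fun _ _ _ => (Real.exp_pos _).le)
          (Real.exp_pos _).le
    _ ≤ Real.exp (-(κ - κ₀)) * K₀ := by gcongr
    _ = K₀ * Real.exp (-(κ - κ₀)) := mul_comm _ _

/-- **(1.26) ABOVE ITS THRESHOLD (abstract catalogue).**  If `Σ_{Y ∋ c} e^{−κ₀ d(Y)} ≤ K₀` for every cube (the tree's `Ineq126` at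
`κ₀`), the sizes are `0` or `≥ 1`, and at most `N₀` members of size `0` pass through any cube, then for every `κ ≥ κ₀`:
`Σ_{Y ∋ c} e^{−κ d(Y)} ≤ N₀ + K₀·e^{−(κ−κ₀)}`. [cite: Balaban1988RG2Cluster, (1.26) p.8] -/
theorem ineq126_above {S : Finset Dom} {cubes : Dom → Finset Cube} {dl : Dom → ℝ} {κ₀ K₀ κ N₀ : ℝ}
    (h126 : Ineq126 S cubes dl κ₀ K₀) (hgap : ∀ Y ∈ S, dl Y = 0 ∨ 1 ≤ dl Y)
    (hN : ∀ c : Cube, (((S.filter fun Y => c ∈ cubes Y).filter fun Y => dl Y = 0).card : ℝ) ≤ N₀) (hκ : κ₀ ≤ κ) :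
    Ineq126 S cubes dl κ (N₀ + K₀ * Real.exp (-(κ - κ₀))) := by
  intro c
  rw [← Finset.sum_filter_add_sum_filter_not (S.filter fun Y => c ∈ cubes Y) (fun Y => dl Y = 0)]
  refine add_le_add ?_ (sum_filter_ne_zero_le h126 hgap hκ c)
  have hz : ∑ Y ∈ (S.filter fun Y => c ∈ cubes Y).filter (fun Y => dl Y = 0), Real.exp (-(κ * dl Y))
      = (((S.filter fun Y => c ∈ cubes Y).filter fun Y => dl Y = 0).card : ℝ) := by
    rw [Finset.card_eq_sum_ones, Nat.cast_sum, Nat.cast_one]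
    refine Finset.sum_congr rfl fun Y hY => ?_
    rw [(Finset.mem_filter.1 hY).2, mul_zero, neg_zero, Real.exp_zero]
  rw [hz]
  exact hN c

end Abstract


end Summit.QuantumFields.BalabanUV.T4Continuum.NE9TorusSizeDichotomy

end
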